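import Summits.BirchSwinnertonDyer.BirchSwinnertonDyer.Theorems.GenusKolyvaginAtTwoPowDvdShaCardAtTwoRTBottomRungTransverseSocket
import Summits.BirchSwinnertonDyer.BirchSwinnertonDyer.Theorems.CMKolyvaginAtInertTwoLowerClosureAtTwo
import HarnessLib

/-!
# Route `CMKolyvaginAtInertTwo`, crux `CMKolyvaginExactAtInertTwo` (stmt-BirchSwinnertonDyer-24277), `stub_lower` —
# PORT OF gk2's LINE 18, FILE C1c: THE BOTTOM RUNG ON THE CM-INERT HABITAT WITHOUT THE PARITY HYPOTHESIS

Seat `bsd-line-cmk2-p1` g19 (cell `bsd-print-cf2`), `--supports stmt-BirchSwinnertonDyer-24277` (helper; closes nothing).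
THEOREMS ONLY (no definition, no named fact, no `sorry`).  BSD is NOT proved by any of this; the crux is not closed here.

WHAT.  gk2's `…RTBottomRungParity` (append ONE deep prime to a level-4 Gross witness keeping 2-primitivity, then the closure of
`…RTBottomRungClosure` either on the witness or on the extended witness, whichever has the right parity).  The single-class Čebotarev it uses
(`equivariantChebotarevAtTwo_eigen_of_not_isSquare`, `r = 1`, with the (NPh)-separation) is replaced on H₂ by g16's full-order pair socket
applied to the pair `(X, X)` (no separation hypothesis); Q2 is taken per instance from Gross 1991 Prop. 3.7 (2) (file A); the closure is
file C1b's.  Statements = gk2's with `(hQ2) (hcm) (hΔ) (hρ) (hns) (hNPh)` replaced by `(hCM) (hin) (hρ2) (h37)`; proofs VERBATIM otherwise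
(credit gk2-p5 / LEAD gk2-p1).

References: [McCallumLMS1991] §5 p. 285 and proof of Prop. 5.2, §4 Cor. 4.5, §3 Cor. 3.2; [Kolyvagin1991MathAnn] Thm. 2.2; [GrossLMS1991]
§3 (3.1)–(3.3), Prop. 3.7 (2).
-/

set_option autoImplicit false
-- the Theorems namespace of this sub repeats the summit name by design (D-0017 nested layout)
set_option linter.dupNamespace false

noncomputable section

open scoped Classical

open Field NumberField IsDedekindDomain Function WeierstrassCurve Rat.HeightOneSpectrum
open Literature.NumberTheory.EllipticCurves
open Literature.NumberTheory.GaloisRepresentations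
open Literature.NumberTheory.GaloisCohomology
open Literature.NumberTheory.EllipticCurves.GrossLMS1991 (prop37_2_reductionCongruence_inert)
open Summit.BirchSwinnertonDyer.Rank1Residual (X11b.KolyvaginAssembly.discr_lt_neg_four JET.exists_compatible_data_of_grossCM)
open Summit.BirchSwinnertonDyer.BirchSwinnertonDyer.Theorems.GenusExact
open Summit.BirchSwinnertonDyer.BirchSwinnertonDyer.Theorems.GenusExact.RelaxedCount
open Summit.BirchSwinnertonDyer.BirchSwinnertonDyer.Theorems.GenusExact.VisiblePairAtTwo
  (natCast_mem_primesEquiv_symm natGenerator_eq_of_natCast_prime_mem natCast_prime_mem_iff_eq exists_natCast_mem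
    torsionBy_two_eq_bot_of_surj torsionH1OfDvd_mem_torsionLocalKer)

namespace Summit.BirchSwinnertonDyer.BirchSwinnertonDyer.Theorems.KolyvaginLowerTwo

variable (W : WeierstrassCurve ℚ) [W.IsElliptic] [W.IsGloballyMinimal] [NeZero (W.conductorNorm ℤ)]
  {K : Type} [Field K] [NumberField K]

/-- **Append a deep prime keeping primitivity, on the CM-inert habitat.**  `W/ℚ` globally minimal with CM, `2` inert in the CM field,
`ρ̄_{E,2}` onto; `K` imaginary quadratic, odd `d_K ≠ −3`, Heegner, Gross 3.7 (2) at `(W, K)`; `L ≥ 2`; `n` a square-free product of level-4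
Gross–Kolyvagin primes with a datum `e`, `addOrderOf c₂(e) = 4`.  THEN there are a Zhang–Kolyvagin prime `ℓ ∤ n` of index `≥ L` with
`Frob = Frob_∞` on `K(E[2^L])` and a datum `e′` at `nℓ` with `addOrderOf c₂(e′) = 4`.  gk2-p5's `RelaxedCount.exists_deep_mul_primitive` with
the single-class Čebotarev + (NPh) replaced by g16's full-order pair socket (pair `(X, X)`, no separation hypothesis) and Q2 per instance.
[cite: McCallumLMS1991, §5 p. 285; §4 Cor. 4.5; §3 Cor. 3.2] [cite: GrossLMS1991, Prop. 3.7 (2)] -/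
theorem exists_deep_mul_primitive (hCM : W.HasCM) (hin : Rank1Residual.CMInert W 2) (hρ2 : W.HasSurjectiveModNGaloisRep 2)
    (hK : IsImaginaryQuadratic K) (hodd : Odd (NumberField.discr K)) (h3 : NumberField.discr K ≠ -3)
    (hHe : SatisfiesHeegnerHypothesis (W.conductorNorm ℤ) K)
    (h37 : prop37_2_reductionCongruence_inert (W.conductorNorm ℤ) W K)
    (c : K ≃ₐ[ℚ] K) (hc : c ≠ 1)
    (Dt : ModularForms.ModularParametrizationData W (W.conductorNorm ℤ)) (β : ℤ) (ι : K →+* ℂ) {L : ℕ} (hL2 : 2 ≤ L)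
    {n : ℕ} (hn : Squarefree n)
    (hnK : ∀ q ∈ n.primeFactors, Zhang2014.IsKolyvaginPrime (W.conductorNorm ℤ) W K 2 q ∧ 2 ≤ Zhang2014.kolyvaginIndex W 2 q)
    (e : KolyvaginHeegnerData Dt β ι n) (he : addOrderOf (e.kolyvaginClass Nat.prime_two 2) = 2 ^ 2) :
    ∃ (ℓ : ℕ) (e' : KolyvaginHeegnerData Dt β ι (n * ℓ)), ℓ.Prime ∧ ℓ ∉ n.primeFactors ∧
      Zhang2014.IsKolyvaginPrime (W.conductorNorm ℤ) W K 2 ℓ ∧ L ≤ Zhang2014.kolyvaginIndex W 2 ℓ ∧ FrobEqFrobInfty W K (2 ^ L) ℓ ∧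
      addOrderOf (e'.kolyvaginClass Nat.prime_two 2) = 2 ^ 2 := by
  haveI : Fact (Nat.Prime 2) := ⟨Nat.prime_two⟩
  have hn0 : n ≠ 0 := hn.ne_zero
  have h2K : Module.finrank ℚ K = 2 := hK.1
  have h4 : NumberField.discr K ≠ -4 := fun h ↦ by
    rw [h] at hodd
    exact (Int.not_even_iff_odd.mpr hodd) ⟨-2, by norm_num⟩
  have hD : NumberField.discr K < -4 := X11b.KolyvaginAssembly.discr_lt_neg_four hK ⟨h3, h4⟩
  have hsurj1 : W.HasSurjectiveModNGaloisRep ((2 : ℤ) ^ 1) := by simpa using hρ2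
  have hL1 : 1 ≤ L := by omega
  have h12 : (1 : ℕ) ≤ 2 := by norm_num
  have h4L : ((2 ^ 2 : ℕ) : ℤ) ∣ ((2 ^ L : ℕ) : ℤ) := by
    obtain ⟨k, hk⟩ := Nat.exists_eq_add_of_le hL2
    exact ⟨((2 ^ k : ℕ) : ℤ), by rw [hk, pow_add]; push_cast; ring⟩
  -- `ι : H¹(K, E[4]) → H¹(K, E[2^L])` is injective
  have hbotK : AddSubgroup.torsionBy (W.baseChange K).toAffine.Point ((2 : ℕ) : ℤ) = ⊥ := by
    rw [eq_bot_iff]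
    intro P hP
    rw [AddSubgroup.mem_bot]
    have hP' : 2 • P = 0 := by
      have h := (mem_torsionBy_iff.mp hP : ((2 : ℕ) : ℤ) • P = 0)
      rwa [natCast_zsmul] at h
    exact forall_two_nsmul_baseChange_of_hasSurjectiveModNGaloisRep_two_of_isImaginaryQuadratic W hρ2 K hK P hP'
  have hιinj : Injective (torsionH1OfDvd (W.baseChange K) h4L) :=
    Summit.BirchSwinnertonDyer.BirchSwinnertonDyer.Theorems.GenusExact.VisiblePairAtTwo.torsionH1OfDvd_pow_injective
      (W.baseChange K) (p := 2) hbotK h4L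
  set cK := e.kolyvaginClass Nat.prime_two 2 with hcK_def
  set X := torsionH1OfDvd (W.baseChange K) h4L cK with hX_def
  have hXord : addOrderOf X = 2 ^ 2 := by rw [hX_def, addOrderOf_injective _ hιinj, he]
  -- sign of `X`
  obtain ⟨hsgn, hτ⟩ := KolyvaginClassSign.sign_conjAct_kolyvaginClass_two hK h3 h4 hodd hHe hsurj1 c hc Dt β ι hn h12 hnK e
  have hτX : conjAct W c ((2 ^ L : ℕ) : ℤ) X = (-W.rootNumber * (-1) ^ n.primeFactors.card) • X := by
    rw [hX_def, conjAct_torsionH1OfDvd, hτ, map_zsmul]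
  -- the full-order Čebotarev for `X` (as the pair `(X, X)`) at level `2^L` on H₂ — no separation hypothesis
  have hinf := KolyvaginImageTwo.infinite_kolyvaginPrime_localization_fullOrder_pair_of_cmInert_socket W K hCM hin hρ2 hK hHe c hc
    L hL1 X X (m := 2) (κ := 2) (by norm_num) (by norm_num) hXord hXord hsgn hsgn hτX hτX
  obtain ⟨ℓ, hℓmem, hℓn⟩ := hinf.exists_notMem_finset n.primeFactors
  obtain ⟨hFrob, hKol, hidx, hloc⟩ := hℓmem
  have hℓp : ℓ.Prime := hKol.1
  have hℓdvd : ¬ ℓ ∣ n := fun h ↦ hℓn (Nat.mem_primeFactors.mpr ⟨hℓp, h, hn0⟩)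
  have hsq : Squarefree (n * ℓ) :=
    (Nat.squarefree_mul ((Nat.Prime.coprime_iff_not_dvd hℓp).mpr hℓdvd).symm).mpr ⟨hn, hℓp.squarefree⟩
  have hall : ∀ q ∈ (n * ℓ).primeFactors, Zhang2014.IsKolyvaginPrime (W.conductorNorm ℤ) W K 2 q ∧ 2 ≤ Zhang2014.kolyvaginIndex W 2 q := by
    intro q hq
    rw [Nat.primeFactors_mul hn0 hℓp.ne_zero, Finset.mem_union] at hq
    rcases hq with hq | hq
    · exact hnK q hq
    · rw [hℓp.primeFactors, Finset.mem_singleton] at hq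
      subst hq
      exact ⟨hKol, hL2.trans hidx⟩
  -- a compatible datum at `nℓ`
  obtain ⟨dℓ, hdℓ⟩ := JET.exists_compatible_data_of_grossCM
    (phi_heegnerPointOfConductor_mem_range_map_ringClassField_holds (W.conductorNorm ℤ) W K) hK hD hHe 2 Dt β ι hn
    (fun q hq ↦ (hnK q hq).1) e
  obtain ⟨hσc, hS, hS', hemb⟩ := hdℓ ℓ hKol hℓn
  set e' := dℓ ℓ hKol hℓn with he'_def
  obtain ⟨v, hv⟩ := exists_natCast_mem (K := K) hℓp
  -- `2•X ∉ tors_v`, hence `2•cK ∉ tors_v` (ι preserves the strict local kernel)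
  have hX2 : ¬ ((2 ^ 1 : ℕ) : ℤ) • cK ∈ (W.baseChange K).torsionLocalKer (v.adicCompletion K) ((2 ^ 2 : ℕ) : ℤ) := by
    intro h
    have h' := torsionH1OfDvd_mem_torsionLocalKer (W.baseChange K) (v.adicCompletion K) h4L h
    rw [map_zsmul] at h'
    have := ((hloc v hv).1 1).mp h'
    omega
  -- Q2 at `v`: `2•c₂(e′) ∉ tors_v`, so `c₂(e′)` has order `4`
  have hQ := kolyvaginRelationAtTwo_at_of_prop37_2 W Dt β ι hρ2 hK h3 h4 hHe h37 2 hsq hℓp hℓdvd hall e e' hσc hS hS' hemb v hv 1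
  have he'2 : ((2 ^ 1 : ℕ) : ℤ) • e'.kolyvaginClass Nat.prime_two 2 ≠ 0 := fun h0 ↦
    hX2 (hQ.2.mp (by rw [h0]; exact AddSubgroup.zero_mem _))
  refine ⟨ℓ, e', hℓp, hℓn, hKol, hidx, hFrob, addOrderOf_eq_prime_pow (n := 1) ?_ ?_⟩
  · intro h
    apply he'2
    rw [natCast_zsmul]
    exact h
  · have h : (((2 ^ 2 : ℕ) : ℤ)) • e'.kolyvaginClass Nat.prime_two 2 = 0 := zsmul_discreteH1_torsion _ _
    rw [natCast_zsmul] at h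
    exact h

/-- **THE BOTTOM RUNG ON H₂, no parity hypothesis.**  As file C1b's `exists_deep_primitive_of_gross_witness`, without the parity of `ω(n₀)`:
the all-deep primitive product has `ω(n) ∈ {ω(n₀), ω(n₀)+1}` (append one deep prime first if the parity is wrong).  gk2's
`RelaxedCount.exists_deep_primitive_of_gross_witness'` re-threaded. [cite: McCallumLMS1991, §5 proof of Prop. 5.2, p. 285]
[cite: Kolyvagin1991MathAnn, Thm. 2.2] -/
theorem exists_deep_primitive_of_gross_witness' (hCM : W.HasCM) (hin : Rank1Residual.CMInert W 2) (hρ2 : W.HasSurjectiveModNGaloisRep 2)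
    (hT : Odd W.tamagawaProduct)
    (hK : IsImaginaryQuadratic K) (hodd : Odd (NumberField.discr K)) (h3 : NumberField.discr K ≠ -3)
    (hHe : SatisfiesHeegnerHypothesis (W.conductorNorm ℤ) K)
    (h37 : prop37_2_reductionCongruence_inert (W.conductorNorm ℤ) W K)
    (Dt : ModularForms.ModularParametrizationData W (W.conductorNorm ℤ)) (β : ℤ) (ι : K →+* ℂ) {L : ℕ} (hL2 : 2 ≤ L)
    (hTr : ∀ (n' : ℕ) (d' : KolyvaginHeegnerData Dt β ι n') (Z : galoisCohomology (W.torsionGaloisModule ((2 ^ 2 : ℕ) : ℤ)) 1),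
      Squarefree n' →
      (∀ q ∈ n'.primeFactors, Zhang2014.IsKolyvaginPrime (W.conductorNorm ℤ) W K 2 q ∧ 2 ≤ Zhang2014.kolyvaginIndex W 2 q ∧
        FrobEqFrobInfty W K (2 ^ 2) q) →
      resTorsion W K ((2 ^ 2 : ℕ) : ℤ) Z = d'.kolyvaginClass Nat.prime_two 2 →
      ∀ (v : HeightOneSpectrum (𝓞 ℚ)) (ℓ : ℕ), ℓ ∈ n'.primeFactors → (ℓ : 𝓞 ℚ) ∈ v.asIdeal →
        L ≤ Zhang2014.kolyvaginIndex W 2 ℓ → FrobEqFrobInfty W K (2 ^ L) ℓ →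
        ∀ 𝔓 ∈ v.primesAbove, ∀ F c₀ : absoluteGaloisGroup ℚ, IsArithFrobAt (𝓞 ℚ) F 𝔓 →
          IsComplexConjugation (Rat.castHom ℝ) c₀ → (∀ P : geomTorsion W ((2 ^ 2 : ℕ) : ℤ), F • P = c₀ • P) →
          ∃ P₁ : geomTorsion W ((2 ^ 2 : ℕ) : ℤ), h1Eval W _ ((2 : ℕ) • Z) F = F • P₁ - P₁)
    {n₀ : ℕ} (hn₀ : Squarefree n₀)
    (hn₀K : ∀ q ∈ n₀.primeFactors, Zhang2014.IsKolyvaginPrime (W.conductorNorm ℤ) W K 2 q ∧ 2 ≤ Zhang2014.kolyvaginIndex W 2 q ∧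
      FrobEqFrobInfty W K (2 ^ 2) q)
    (e₀ : KolyvaginHeegnerData Dt β ι n₀) (he₀ : addOrderOf (e₀.kolyvaginClass Nat.prime_two 2) = 2 ^ 2) :
    ∃ (n : ℕ) (e : KolyvaginHeegnerData Dt β ι n), Squarefree n ∧
      (n.primeFactors.card = n₀.primeFactors.card ∨ n.primeFactors.card = n₀.primeFactors.card + 1) ∧
      (∀ q ∈ n.primeFactors, Zhang2014.IsKolyvaginPrime (W.conductorNorm ℤ) W K 2 q ∧ L ≤ Zhang2014.kolyvaginIndex W 2 q ∧
        FrobEqFrobInfty W K (2 ^ L) q) ∧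
      addOrderOf (e.kolyvaginClass Nat.prime_two 2) = 2 ^ 2 := by
  have h2K : Module.finrank ℚ K = 2 := hK.1
  -- the sign `−w(E)(−1)^{ω+1}` is `±1`
  have hw : W.rootNumber = 1 ∨ W.rootNumber = -1 := W.rootNumber_eq_one_or
  by_cases hpar : -W.rootNumber * (-1) ^ (n₀.primeFactors.card + 1) = 1
  · obtain ⟨n, e, hn, hcard, hK', he⟩ := KolyvaginLowerTwo.exists_deep_primitive_of_gross_witness W hCM hin hρ2 hT hK hodd h3 hHe h37 Dt β ι
      hL2 hTr hn₀ hn₀K e₀ he₀ hpar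
    exact ⟨n, e, hn, Or.inl hcard, hK', he⟩
  · -- append one deep prime to flip the parity
    obtain ⟨τ, -, hτ, -⟩ := PlusDescent.exists_gal_ne_one_sqrt_discr (K := K) h2K
    obtain ⟨ℓ, e₁, hℓp, hℓn, hKol, hidx, hFrob, he₁⟩ := KolyvaginLowerTwo.exists_deep_mul_primitive W hCM hin hρ2 hK hodd h3 hHe h37 τ hτ
      Dt β ι hL2 hn₀ (fun q hq ↦ ⟨(hn₀K q hq).1, (hn₀K q hq).2.1⟩) e₀ he₀
    have hn0 : n₀ ≠ 0 := hn₀.ne_zero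
    have hℓdvd : ¬ ℓ ∣ n₀ := fun h ↦ hℓn (Nat.mem_primeFactors.mpr ⟨hℓp, h, hn0⟩)
    have hsq : Squarefree (n₀ * ℓ) :=
      (Nat.squarefree_mul ((Nat.Prime.coprime_iff_not_dvd hℓp).mpr hℓdvd).symm).mpr ⟨hn₀, hℓp.squarefree⟩
    have hpf : (n₀ * ℓ).primeFactors = insert ℓ n₀.primeFactors := by
      rw [Nat.primeFactors_mul hn0 hℓp.ne_zero, hℓp.primeFactors, Finset.union_comm]; rfl
    have hcard : (n₀ * ℓ).primeFactors.card = n₀.primeFactors.card + 1 := by rw [hpf, Finset.card_insert_of_notMem hℓn]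
    have hK' : ∀ q ∈ (n₀ * ℓ).primeFactors, Zhang2014.IsKolyvaginPrime (W.conductorNorm ℤ) W K 2 q ∧ 2 ≤ Zhang2014.kolyvaginIndex W 2 q ∧
        FrobEqFrobInfty W K (2 ^ 2) q := by
      intro q hq
      rw [hpf, Finset.mem_insert] at hq
      rcases hq with rfl | hq
      · exact ⟨hKol, hL2.trans hidx, hFrob.of_dvd (pow_dvd_pow 2 hL2)⟩
      · exact hn₀K q hq
    have hpm : -W.rootNumber * (-1) ^ (n₀.primeFactors.card + 1) = 1 ∨
        -W.rootNumber * (-1) ^ (n₀.primeFactors.card + 1) = -1 := by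
      rcases hw with h | h <;> rcases neg_one_pow_eq_or ℤ (n₀.primeFactors.card + 1) with h1 | h1 <;> rw [h, h1] <;> norm_num
    have hm1 : -W.rootNumber * (-1) ^ (n₀.primeFactors.card + 1) = -1 := hpm.resolve_left hpar
    have hpar' : -W.rootNumber * (-1) ^ ((n₀ * ℓ).primeFactors.card + 1) = 1 := by
      rw [hcard, pow_succ, ← mul_assoc, hm1]; norm_num
    obtain ⟨n, e, hn, hcardn, hKn, he⟩ := KolyvaginLowerTwo.exists_deep_primitive_of_gross_witness W hCM hin hρ2 hT hK hodd h3 hHe h37 Dt β ι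
      hL2 hTr hsq hK' e₁ he₁ hpar'
    exact ⟨n, e, hn, Or.inr (by rw [hcardn, hcard]), hKn, he⟩

/-! ## The socket `hbot` of the KS assembly (margin-`k` class), with the (V44)-socket discharged -/

/-- **THE SOCKET `hbot` OF THE KS ASSEMBLY ON H₂, margin-`k` class** — gk2-p5 g24's `RelaxedCount.hbot_socket_margin` re-threaded: for every
prime predicate `G` implied by `Zhang–Kolyvagin q ∧ L + k ≤ index q ∧ FrobEqFrobInfty W K (2^(L+k)) q`, from a level-4 Gross witness (`n₀`
square-free of Zhang–Kolyvagin primes of index `≥ 2` with `FrobEqFrobInfty W K 4`, a datum with `addOrderOf c₂(e₀) = 4`), modulo the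
(V44)-socket `hTr` at level `L + k` and Gross 3.7 (2) at `(W, K)`:  VERBATIM
`∃ n d, Squarefree n ∧ (∀ q ∈ n.primeFactors, (ZK q ∧ L ≤ index q) ∧ G q) ∧ addOrderOf c_L(d) = 2^L`.
[cite: McCallumLMS1991, §5 proof of Prop. 5.2, p. 285] [cite: Kolyvagin1991MathAnn, Thm. 2.2] -/
theorem hbot_socket_margin (hCM : W.HasCM) (hin : Rank1Residual.CMInert W 2) (hρ2 : W.HasSurjectiveModNGaloisRep 2)
    (hT : Odd W.tamagawaProduct)
    (hK : IsImaginaryQuadratic K) (hodd : Odd (NumberField.discr K)) (h3 : NumberField.discr K ≠ -3)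
    (hHe : SatisfiesHeegnerHypothesis (W.conductorNorm ℤ) K)
    (h37 : prop37_2_reductionCongruence_inert (W.conductorNorm ℤ) W K)
    (Dt : ModularForms.ModularParametrizationData W (W.conductorNorm ℤ)) (β : ℤ) (ι : K →+* ℂ) {L : ℕ} (hL2 : 2 ≤ L) (k : ℕ)
    (hTr : ∀ (n' : ℕ) (d' : KolyvaginHeegnerData Dt β ι n') (Z : galoisCohomology (W.torsionGaloisModule ((2 ^ 2 : ℕ) : ℤ)) 1),
      Squarefree n' →
      (∀ q ∈ n'.primeFactors, Zhang2014.IsKolyvaginPrime (W.conductorNorm ℤ) W K 2 q ∧ 2 ≤ Zhang2014.kolyvaginIndex W 2 q ∧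
        FrobEqFrobInfty W K (2 ^ 2) q) →
      resTorsion W K ((2 ^ 2 : ℕ) : ℤ) Z = d'.kolyvaginClass Nat.prime_two 2 →
      ∀ (v : HeightOneSpectrum (𝓞 ℚ)) (ℓ : ℕ), ℓ ∈ n'.primeFactors → (ℓ : 𝓞 ℚ) ∈ v.asIdeal →
        L + k ≤ Zhang2014.kolyvaginIndex W 2 ℓ → FrobEqFrobInfty W K (2 ^ (L + k)) ℓ →
        ∀ 𝔓 ∈ v.primesAbove, ∀ F c₀ : absoluteGaloisGroup ℚ, IsArithFrobAt (𝓞 ℚ) F 𝔓 →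
          IsComplexConjugation (Rat.castHom ℝ) c₀ → (∀ P : geomTorsion W ((2 ^ 2 : ℕ) : ℤ), F • P = c₀ • P) →
          ∃ P₁ : geomTorsion W ((2 ^ 2 : ℕ) : ℤ), h1Eval W _ ((2 : ℕ) • Z) F = F • P₁ - P₁)
    (G : ℕ → Prop)
    (hG : ∀ q : ℕ, Zhang2014.IsKolyvaginPrime (W.conductorNorm ℤ) W K 2 q → L + k ≤ Zhang2014.kolyvaginIndex W 2 q →
      FrobEqFrobInfty W K (2 ^ (L + k)) q → G q)
    {n₀ : ℕ} (hn₀ : Squarefree n₀)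
    (hn₀K : ∀ q ∈ n₀.primeFactors, Zhang2014.IsKolyvaginPrime (W.conductorNorm ℤ) W K 2 q ∧ 2 ≤ Zhang2014.kolyvaginIndex W 2 q ∧
      FrobEqFrobInfty W K (2 ^ 2) q)
    (e₀ : KolyvaginHeegnerData Dt β ι n₀) (he₀ : addOrderOf (e₀.kolyvaginClass Nat.prime_two 2) = 2 ^ 2) :
    ∃ (n : ℕ) (d : KolyvaginHeegnerData Dt β ι n), Squarefree n ∧
      (∀ q ∈ n.primeFactors, (Zhang2014.IsKolyvaginPrime (W.conductorNorm ℤ) W K 2 q ∧ L ≤ Zhang2014.kolyvaginIndex W 2 q) ∧ G q) ∧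
      addOrderOf (d.kolyvaginClass Nat.prime_two L) = 2 ^ L := by
  have hL2' : 2 ≤ L + k := by omega
  obtain ⟨n, e, hn, -, hK', he⟩ := KolyvaginLowerTwo.exists_deep_primitive_of_gross_witness' W hCM hin hρ2 hT hK hodd h3 hHe h37 Dt β ι
    hL2' hTr hn₀ hn₀K e₀ he₀
  have hK'' : ∀ q ∈ n.primeFactors, Zhang2014.IsKolyvaginPrime (W.conductorNorm ℤ) W K 2 q ∧ L ≤ Zhang2014.kolyvaginIndex W 2 q :=
    fun q hq ↦ ⟨(hK' q hq).1, le_trans (Nat.le_add_right L k) (hK' q hq).2.1⟩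
  exact ⟨n, e, hn, fun q hq ↦ ⟨hK'' q hq, hG q (hK' q hq).1 (hK' q hq).2.1 (hK' q hq).2.2⟩,
    addOrderOf_kolyvaginClass_two_pow_eq_of_four W hK hodd h3 hHe hρ2 Dt β ι hL2 hn hK'' e he⟩

/-- **THE SOCKET `hbot` ON H₂ WITH THE (V44)-SOCKET DISCHARGED** (`L + k ≥ 3`): the previous theorem composed with gk2-p3 g24's image-free
`TransverseValue.hTr_of_three_le` (Howard's Lemma 2.7.3 at `2` read at `τ_{F²}`; `Δ < 0` from the habitat).  Displayed residual: Gross 3.7 (2)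
at `(W, K)` only. [cite: McCallumLMS1991, §5 proof of Prop. 5.2, p. 285] [cite: Kolyvagin1991MathAnn, Thm. 2.2]
[cite: Howard2004HeegnerKolyvagin, Lemma 2.7.3] -/
theorem hbot_socket_margin_of_three_le (hCM : W.HasCM) (hin : Rank1Residual.CMInert W 2) (hρ2 : W.HasSurjectiveModNGaloisRep 2)
    (hT : Odd W.tamagawaProduct)
    (hK : IsImaginaryQuadratic K) (hodd : Odd (NumberField.discr K)) (h3 : NumberField.discr K ≠ -3)
    (hHe : SatisfiesHeegnerHypothesis (W.conductorNorm ℤ) K)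
    (h37 : prop37_2_reductionCongruence_inert (W.conductorNorm ℤ) W K)
    (Dt : ModularForms.ModularParametrizationData W (W.conductorNorm ℤ)) (β : ℤ) (ι : K →+* ℂ)
    [∀ j : ℕ, NumberField (ringClassField K ι j)] {L : ℕ} (hL2 : 2 ≤ L) (k : ℕ) (hLk : 3 ≤ L + k)
    (G : ℕ → Prop)
    (hG : ∀ q : ℕ, Zhang2014.IsKolyvaginPrime (W.conductorNorm ℤ) W K 2 q → L + k ≤ Zhang2014.kolyvaginIndex W 2 q →
      FrobEqFrobInfty W K (2 ^ (L + k)) q → G q)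
    {n₀ : ℕ} (hn₀ : Squarefree n₀)
    (hn₀K : ∀ q ∈ n₀.primeFactors, Zhang2014.IsKolyvaginPrime (W.conductorNorm ℤ) W K 2 q ∧ 2 ≤ Zhang2014.kolyvaginIndex W 2 q ∧
      FrobEqFrobInfty W K (2 ^ 2) q)
    (e₀ : KolyvaginHeegnerData Dt β ι n₀) (he₀ : addOrderOf (e₀.kolyvaginClass Nat.prime_two 2) = 2 ^ 2) :
    ∃ (n : ℕ) (d : KolyvaginHeegnerData Dt β ι n), Squarefree n ∧
      (∀ q ∈ n.primeFactors, (Zhang2014.IsKolyvaginPrime (W.conductorNorm ℤ) W K 2 q ∧ L ≤ Zhang2014.kolyvaginIndex W 2 q) ∧ G q) ∧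
      addOrderOf (d.kolyvaginClass Nat.prime_two L) = 2 ^ L :=
  have hΔ : W.Δ < 0 := KolyvaginEigenTwo.Δ_neg_of_cmInert_two W hCM hin hρ2
  KolyvaginLowerTwo.hbot_socket_margin W hCM hin hρ2 hT hK hodd h3 hHe h37 Dt β ι hL2 k
    (TransverseValue.hTr_of_three_le W hK hodd h3 hΔ Dt β ι hLk) G hG hn₀ hn₀K e₀ he₀

end Summit.BirchSwinnertonDyer.BirchSwinnertonDyer.Theorems.KolyvaginLowerTwo

end
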